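import Summits.AtomisticToContinuum.BoseEinsteinCondensation.Theses.BlockLatticeFSum
import Summits.AtomisticToContinuum.BoseEinsteinCondensation.Theses.BECIntegerBlockRotor
import Literature.MathematicalPhysics.QuantumManyBody.PeriodicBoseGasUpperBoundProofs
import Literature.MathematicalPhysics.QuantumManyBody.BoseGasFreeDirichletBEC
import Literature.MathematicalPhysics.QuantumManyBody.BoseGasThermodynamicLimitRuelle
import HarnessLib

/-!
# `BlockCondensation` (stmt-AtomisticToContinuum-13595) carved beneath the crux:
# `BlockCondensation ⟸ U ∧ F ⟸ U ∧ F♭`  (decomp-a2c · lens-6 «barrier-complement carving» · gen 27)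

NODE (rung 0, crux level).  The crux `BlockCondensation` (GP-scale block floor of periodic
near-minimisers; rank 3 of `BlockLatticeFSum`, rank 5 of `BECIntegerBlockRotor`; ONE decl body
shared by the two route files) is decided by two pieces:
* **U** = `LSSY2005_upperBound_periodic` — the Dyson–LSSY periodic upper bound
  `E₀^per(N,L) ≤ 4πρ₁a(1 + C a/b)N` for `N ≥ 2`, `2R₀ < L`, `a/b ≤ c`, box-uniform; PROVED in the
  tree as `LSSY2005_upperBound_periodic_holds` ([LSSY2005, Thm. 2.2 (2.14)]).  It converts the
  crux's *near-minimiser* hypothesis `E(Ψ) ≤ E₀^per + δ` into an ABSOLUTE energy budget, with the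
  affordable slack `δ = (τ/2)·(N/L³)·N` (order `ρN`, not order `1`).
* **F** = `PeriodicBudgetBlockFloor` — the block floor for every periodic state under the absolute
  budget `E(Ψ) ≤ (4πa + τ)(N/L³)N`, in the tree's sub-cell vocabulary (`SubIdx`, `subMode`,
  `occupation` of the cell-restricted wave function).  TAG WEAKER / leaf ATTACKABLE: block side
  `ℓ = L/K ∈ [A/√ρ, 2A/√ρ]` is the Gross–Pitaevskii healing scale (`ℓ/ξ = A·√(8πa)` fixed — the
  PROVED side of the barrier `Literature.Barriers.AtomisticToContinuum.KineticGapLengthScales`; it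
  says nothing about `ℓ ≫ ξ`, where the summit `BoseEinsteinCondensation` lives); its DIRICHLET
  TWIN is the tree theorem `floor_of_scatteringLength_pos_sharp`
  (`BoseGasSubcellCondensationSharp.lean`), assembled from the deterministic budget-form floor
  inequality `natCast_le_sum_occupation_add_budget`, LSSY Lemma 5.2 in Neumann cells
  (`locLowerBound_neumann`), Thm 2.4 Neumann (`LSSY2005_lowerBound_neumann_holds`), Lemma 4.1
  (`LSSY2005_lemma41_holds`) and `occupation_bookkeeping` — none of which uses the Dirichlet
  condition except the UPPER bound `eventually_groundStateEnergy_le_dyson`, which U replaces.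
  [LSSY2005, Thm 5.1 p. 36, Lemma 5.2 (5.5)–(5.14) p. 37, (5.15)–(5.17) p. 38, Thm 2.4]: what is
  missing is Lean transport (size L), not mathematics; NOT obtainable from `Fournais2020_condensation`
  (periodic b.c. on the small box tied to `L = C_L(ρa³)^{-δ}(ρa)^{-1/2}`) nor from
  `Junge2026_neumannBox_pinnedLowerBound` (scale `a(ρa³)^{-1/2-η}`).

Also proved here: `blockMode_eq_subMode`, `cell_indicator_subMode`, `sum_cellOccupation_block_eq` —
the crux's verbatim block sum `∑_B cellOccupation N L (1_{⌊Kx/L⌋ = B}·(L/K)^{-3/2}) Ψ` IS the tree's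
`∑_q occupation N (subMode (L/K) q) (1_{cellN} Ψ)`.

Beneath F sits the boundary-condition-free leaf **F♭** = `CellNBudgetBlockFloor` (the same floor
for an arbitrary Bose-symmetric `C¹` function normalised on `[0,L)^{3N}` under the PLAIN cell-energy
budget — no periodicity, no `v^per`): `periodicBudgetBlockFloor_of_cellN : F♭ → F`
(`interaction_le_periodicInteraction`), so `BlockCondensation ⟸ U ∧ F♭`
(`blockCondensation_of_cellNFloor`, `rotor_blockCondensation_of_cellNFloor`).  F♭ is the prover's
target: the tree's Dirichlet engine re-typed over the carrier it actually uses.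

Main theorems: `blockCondensation_of_upperBound_floor : U → F → BlockLatticeFSum.BlockCondensation`,
`blockCondensation_of_floor : F → …` (U discharged by the tree), `rotor_blockCondensation_of_floor`
(same decl body, route `BECIntegerBlockRotor`).  No `sorry`, no new axioms; definitions: `blockMode`
(the crux's verbatim block mode), `PeriodicBudgetBlockFloor` (F) and `CellNBudgetBlockFloor` (F♭),
the latter two tagged `@[conjecture]` (open obligation nodes of our theories, not Literature facts).
-/

noncomputable section

open MeasureTheory Filter Set
open scoped ENNReal NNReal BigOperators

namespace Summit.AtomisticToContinuum.BoseEinsteinCondensation.Theorems.BlockCondensationCarving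

open Literature.MathematicalPhysics.QuantumManyBody.BoseGas

/-! ### The crux's block mode is the tree's sub-cell mode -/

/-- The block mode of the crux `BlockCondensation`, verbatim: `(L/K)^{-3/2}` on the block
`{x | ∀ j, ⌊K x_j / L⌋ = B_j}`, `0` elsewhere. [tree: Theses.BlockLatticeFSum.BlockCondensation] -/
def blockMode (K : ℕ) (L : ℝ) (B : Fin 3 → Fin K) (x : EuclideanSpace ℝ (Fin 3)) : ℂ :=
  if (∀ j : Fin 3, ⌊(K : ℝ) * x j / L⌋ = (((B j : Fin K) : ℕ) : ℤ)) then
    ((((Real.sqrt ((L / (K : ℝ)) ^ 3))⁻¹ : ℝ) : ℂ)) else 0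

/-- `⌊K x / L⌋ = b ↔ (L/K)·b ≤ x < (L/K)·b + L/K` for `K, L > 0`. [folklore] -/
theorem floor_eq_iff_mem_block {K : ℕ} {L : ℝ} (hK : 0 < K) (hL : 0 < L) (x : ℝ) (b : ℕ) :
    ⌊(K : ℝ) * x / L⌋ = ((b : ℕ) : ℤ) ↔
      L / (K : ℝ) * (b : ℝ) ≤ x ∧ x < L / (K : ℝ) * (b : ℝ) + L / (K : ℝ) := by
  have hKr : (0 : ℝ) < K := by exact_mod_cast hK
  rw [Int.floor_eq_iff]
  push_cast
  constructor
  · rintro ⟨h1, h2⟩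
    constructor
    · rw [le_div_iff₀ hL] at h1
      rw [div_mul_eq_mul_div, div_le_iff₀ hKr]
      linarith
    · rw [div_lt_iff₀ hL] at h2
      have : L / (K : ℝ) * (b : ℝ) + L / (K : ℝ) = L * ((b : ℝ) + 1) / (K : ℝ) := by
        field_simp
      rw [this, lt_div_iff₀ hKr]
      linarith
  · rintro ⟨h1, h2⟩
    constructor
    · rw [le_div_iff₀ hL]
      rw [div_mul_eq_mul_div, div_le_iff₀ hKr] at h1
      linarith
    · rw [div_lt_iff₀ hL]
      have : L / (K : ℝ) * (b : ℝ) + L / (K : ℝ) = L * ((b : ℝ) + 1) / (K : ℝ) := by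
        field_simp
      rw [this, lt_div_iff₀ hKr] at h2
      linarith

/-- The crux's block mode `B` equals the tree's sub-cell constant mode `subMode (L/K) B`.
[folklore] -/
theorem blockMode_eq_subMode {K : ℕ} {L : ℝ} (hK : 0 < K) (hL : 0 < L) (B : Fin 3 → Fin K) :
    blockMode K L B = subMode (L / (K : ℝ)) B := by
  funext x
  classical
  rw [subMode_eq_indicator, Set.indicator_apply, blockMode]
  have hiff : (∀ j : Fin 3, ⌊(K : ℝ) * x j / L⌋ = (((B j : Fin K) : ℕ) : ℤ)) ↔
      x ∈ subCell (L / (K : ℝ)) B := by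
    rw [mem_subCell]
    exact forall_congr' fun j => floor_eq_iff_mem_block hK hL (x j) (B j)
  by_cases hx : x ∈ subCell (L / (K : ℝ)) B
  · rw [if_pos (hiff.2 hx), if_pos hx]
    push_cast
    rfl
  · rw [if_neg (fun h => hx (hiff.1 h)), if_neg hx]

/-- A sub-cell mode of side `L/K` is supported in the cell `[0,L)³`, so restricting it to the cell
does nothing. [folklore] -/
theorem cell_indicator_subMode {K : ℕ} {L : ℝ} (hK : 0 < K) (hL : 0 < L) (q : SubIdx K) :
    (cell L).indicator (subMode (L / (K : ℝ)) q) = subMode (L / (K : ℝ)) q := by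
  have hKr : (0 : ℝ) < K := by exact_mod_cast hK
  have hℓ : 0 < L / (K : ℝ) := div_pos hL hKr
  rw [Set.indicator_eq_self, subMode_eq_indicator]
  refine (Set.support_indicator_subset).trans ?_
  have h := subCell_subset_cell hℓ q
  rwa [mul_div_cancel₀ L hKr.ne'] at h

/-- The crux's block-occupation sum is the tree's sub-cell occupation sum of the cell-restricted
wave function. [folklore] -/
theorem sum_cellOccupation_block_eq {K N : ℕ} {L : ℝ} (hK : 0 < K) (hL : 0 < L)
    (Ψ : Config N → ℂ) :
    (∑ B : Fin 3 → Fin K, cellOccupation N L (blockMode K L B) Ψ) =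
      ∑ q : SubIdx K, occupation N (subMode (L / (K : ℝ)) q) ((cellN N L).indicator Ψ) := by
  refine Finset.sum_congr rfl fun B _ => ?_
  rw [cellOccupation, blockMode_eq_subMode hK hL, cell_indicator_subMode hK hL]

/-! ### The piece F -/

/-- **F = `PeriodicBudgetBlockFloor`** (piece of the carving; TAG WEAKER · leaf ATTACKABLE).
For every repulsive finite-range `v`, block constant `A > 0` and loss `η > 0` there are a density
cap `ρ₀ > 0`, a budget slope `τ > 0` and a particle threshold `N₀` — BOX-UNIFORM — such that every
periodic `N`-particle state on a torus of side `L` (`N ≥ N₀`, `N ≤ ρ₀L³`) whose energy obeys the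
ABSOLUTE budget `E(Ψ) ≤ (4πa + τ)·(N/L³)·N` has at least `(1-η)N` particles in the sub-cell
constant modes of side `L/K`, for every even `K > 0` in the GP window
`A/√ρ ≤ L/K ≤ 2A/√ρ` (`ρ = N/L³`).  Dirichlet twin PROVED: `floor_of_scatteringLength_pos_sharp`;
engine `natCast_le_sum_occupation_add_budget`; gap = periodic transport G1–G4 (memo).
[cite: LSSY2005, Thm. 5.1 (5.15)–(5.17), Lemma 5.2; folklore (budget form)] -/
@[conjecture] def PeriodicBudgetBlockFloor : Prop :=
  ∀ v : ℝ → ℝ≥0∞, IsRepulsiveFiniteRange v → ∀ A : ℝ, 0 < A → ∀ η : ℝ, 0 < η →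
    ∃ ρ₀ : ℝ, 0 < ρ₀ ∧ ∃ τ : ℝ, 0 < τ ∧ ∃ N₀ : ℕ, ∀ (N : ℕ) (L : ℝ), 0 < L → N₀ ≤ N →
      (N : ℝ) ≤ ρ₀ * L ^ 3 → ∀ Ψ : PeriodicTrialState N L,
        periodicEnergy v Ψ ≤ ENNReal.ofReal
            ((4 * Real.pi * (scatteringLength v).toReal + τ) * ((N : ℝ) / L ^ 3) * N) →
        ∀ K : ℕ, Even K → 0 < K →
          A / Real.sqrt ((N : ℝ) / L ^ 3) ≤ L / (K : ℝ) ∧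
            L / (K : ℝ) ≤ 2 * A / Real.sqrt ((N : ℝ) / L ^ 3) →
          ENNReal.ofReal ((1 - η) * N) ≤
            ∑ q : SubIdx K, occupation N (subMode (L / (K : ℝ)) q) ((cellN N L).indicator Ψ.ψ)

/-! ### The boundary-condition-free leaf F♭ beneath F -/

/-- **F♭ = `CellNBudgetBlockFloor`** (leaf beneath F; TAG WEAKER · leaf ATTACKABLE — the prover's
actual target).  The block floor for an ARBITRARY Bose-symmetric `C¹` function `ψ` on `(ℝ³)^N`,
normalised on the fundamental cell `[0,L)^{3N}`, whose PLAIN energy on the cell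
`∫_{[0,L)^{3N}} (|∇ψ|² + ∑_{i<j} v(|xᵢ-xⱼ|)|ψ|²)` obeys the absolute budget `(4πa+τ)(N/L³)N`:
NO boundary condition, NO periodicity, NO periodised potential.  This is exactly the carrier
generality the tree's Dirichlet engine (`BoseGasSubcellCondensation.lean` Parts A–C, M;
`natCast_le_sum_occupation_add_budget`) really uses — the Dirichlet condition `TrialState.eq_zero`
enters there only to restrict whole-space integrals to the box (support bookkeeping at
`occupation_add_depletion_eq`, `sum_mass_cellSet_eq_one`, `sum_sum_groupEnergy_le_energy`), while
every lower bound is per Neumann cell.  Prover plan (memo G1): re-type Parts A–C, M over this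
carrier with all integrals `∫⁻ … in cellN`, then run `floor_of_scatteringLength_pos_sharp`'s
density-only parameter choice (`floorParams_eventually`, `floorBudgetSum_eventually_le`) with
`ρ := N/L³` and slack `τρN` in place of `+1` (which removes the only `N`-threshold).
[cite: LSSY2005, Thm. 5.1 (5.15)–(5.17), Lemma 5.2, Lemma 4.1; folklore (carrier form)] -/
@[conjecture] def CellNBudgetBlockFloor : Prop :=
  ∀ v : ℝ → ℝ≥0∞, IsRepulsiveFiniteRange v → ∀ A : ℝ, 0 < A → ∀ η : ℝ, 0 < η →
    ∃ ρ₀ : ℝ, 0 < ρ₀ ∧ ∃ τ : ℝ, 0 < τ ∧ ∃ N₀ : ℕ, ∀ (N : ℕ) (L : ℝ), 0 < L → N₀ ≤ N →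
      (N : ℝ) ≤ ρ₀ * L ^ 3 → ∀ ψ : Config N → ℂ, ContDiff ℝ 1 ψ →
        (∀ (σ : Equiv.Perm (Fin N)) (X : Config N), ψ (X ∘ σ) = ψ X) →
        ∫⁻ X in cellN N L, (‖ψ X‖₊ : ℝ≥0∞) ^ 2 = 1 →
        ∫⁻ X in cellN N L, kineticDensity ψ X + interaction v X * (‖ψ X‖₊ : ℝ≥0∞) ^ 2 ≤
          ENNReal.ofReal
            ((4 * Real.pi * (scatteringLength v).toReal + τ) * ((N : ℝ) / L ^ 3) * N) →
        ∀ K : ℕ, Even K → 0 < K →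
          A / Real.sqrt ((N : ℝ) / L ^ 3) ≤ L / (K : ℝ) ∧
            L / (K : ℝ) ≤ 2 * A / Real.sqrt ((N : ℝ) / L ^ 3) →
          ENNReal.ofReal ((1 - η) * N) ≤
            ∑ q : SubIdx K, occupation N (subMode (L / (K : ℝ)) q) ((cellN N L).indicator ψ)

/-- The plain energy of a periodic state on the fundamental cell is at most its periodic energy
(`v ≤ v^per` termwise, `interaction_le_periodicInteraction`). [cite: Fournais2020, (1.1)] -/
theorem cellN_plainEnergy_le_periodicEnergy {N : ℕ} {L : ℝ} (v : ℝ → ℝ≥0∞)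
    (Ψ : PeriodicTrialState N L) :
    ∫⁻ X in cellN N L, kineticDensity Ψ.ψ X + interaction v X * (‖Ψ.ψ X‖₊ : ℝ≥0∞) ^ 2 ≤
      periodicEnergy v Ψ := by
  unfold periodicEnergy
  refine lintegral_mono fun X => ?_
  have h := interaction_le_periodicInteraction v L X
  gcongr

/-- **F ⟸ F♭**: a periodic trial state is a Bose-symmetric `C¹` function normalised on the cell
whose plain cell energy is below its periodic energy. [folklore] -/
theorem periodicBudgetBlockFloor_of_cellN (h : CellNBudgetBlockFloor) :
    PeriodicBudgetBlockFloor := by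
  intro v hv A hA η hη
  obtain ⟨ρ₀, hρ₀, τ, hτ, N₀, H⟩ := h v hv A hA η hη
  refine ⟨ρ₀, hρ₀, τ, hτ, N₀, fun N L hL hN hNL Ψ hE K hKe hK hwin => ?_⟩
  exact H N L hL hN hNL Ψ.ψ Ψ.contDiff Ψ.symm Ψ.norm_eq
    ((cellN_plainEnergy_le_periodicEnergy v Ψ).trans hE) K hKe hK hwin

/-! ### The carving `BlockCondensation ⟸ U ∧ F` — arithmetic of the join -/

/-- Density-cap arithmetic: for `ρ₁` below an explicit cap, the Dyson–LSSY ratio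
`t = a/b = a·(4πρ₁/3)^{1/3}` is `≤ c` and `4πaC·t ≤ τ/2`. [folklore] -/
theorem densityCap_arith {a C c τ : ℝ} (ha : 0 ≤ a) (hC : 0 < C) (hc : 0 < c) (hτ : 0 < τ) :
    ∃ ρs : ℝ, 0 < ρs ∧ ∀ ρ₁ : ℝ, 0 < ρ₁ → ρ₁ ≤ ρs →
      a / (4 * Real.pi * ρ₁ / 3) ^ (-(1 : ℝ) / 3) ≤ c ∧
      4 * Real.pi * a * C * (a / (4 * Real.pi * ρ₁ / 3) ^ (-(1 : ℝ) / 3)) ≤ τ / 2 := by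
  have hden : 0 < 2 * (4 * Real.pi * a * C + 1) := by positivity
  obtain ⟨m, hm_def⟩ : ∃ m : ℝ, m = min c (τ / (2 * (4 * Real.pi * a * C + 1))) := ⟨_, rfl⟩
  have hm : 0 < m := by rw [hm_def]; exact lt_min hc (div_pos hτ hden)
  have hmc : m ≤ c := by rw [hm_def]; exact min_le_left _ _
  have hmτ : m ≤ τ / (2 * (4 * Real.pi * a * C + 1)) := by rw [hm_def]; exact min_le_right _ _
  obtain ⟨q, hq_def⟩ : ∃ q : ℝ, q = m / (a + 1) := ⟨_, rfl⟩
  have hq : 0 < q := by rw [hq_def]; exact div_pos hm (by positivity)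
  refine ⟨3 * q ^ 3 / (4 * Real.pi), by positivity, fun ρ₁ hρ₁ hρ₁le => ?_⟩
  have hx : 0 < 4 * Real.pi * ρ₁ / 3 := by positivity
  have hxq : 4 * Real.pi * ρ₁ / 3 ≤ q ^ 3 := by
    have h1 : 4 * Real.pi * ρ₁ / 3 ≤ 4 * Real.pi * (3 * q ^ 3 / (4 * Real.pi)) / 3 := by gcongr
    have h2 : 4 * Real.pi * (3 * q ^ 3 / (4 * Real.pi)) / 3 = q ^ 3 := by
      field_simp
    linarith
  have hx3 : (4 * Real.pi * ρ₁ / 3) ^ ((1 : ℝ) / 3) ≤ q := by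
    have h1 : (4 * Real.pi * ρ₁ / 3) ^ ((1 : ℝ) / 3) ≤ (q ^ 3) ^ ((1 : ℝ) / 3) :=
      Real.rpow_le_rpow hx.le hxq (by norm_num)
    have h2 : (q ^ 3) ^ ((1 : ℝ) / 3) = q := by
      rw [← Real.rpow_natCast q 3, ← Real.rpow_mul hq.le]
      norm_num
    rwa [h2] at h1
  have ht_eq : a / (4 * Real.pi * ρ₁ / 3) ^ (-(1 : ℝ) / 3) =
      a * (4 * Real.pi * ρ₁ / 3) ^ ((1 : ℝ) / 3) := by
    rw [show (-(1 : ℝ) / 3) = -((1 : ℝ) / 3) by ring, Real.rpow_neg hx.le, div_inv_eq_mul]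
  have htm : a / (4 * Real.pi * ρ₁ / 3) ^ (-(1 : ℝ) / 3) ≤ m := by
    rw [ht_eq]
    calc a * (4 * Real.pi * ρ₁ / 3) ^ ((1 : ℝ) / 3) ≤ (a + 1) * q := by
          gcongr
          · linarith
      _ = m := by rw [hq_def]; field_simp
  refine ⟨htm.trans hmc, ?_⟩
  have h2 : 4 * Real.pi * a * C * (a / (4 * Real.pi * ρ₁ / 3) ^ (-(1 : ℝ) / 3)) ≤
      4 * Real.pi * a * C * (τ / (2 * (4 * Real.pi * a * C + 1))) :=
    mul_le_mul_of_nonneg_left (htm.trans hmτ) (by positivity)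
  have h3 : 4 * Real.pi * a * C * (τ / (2 * (4 * Real.pi * a * C + 1))) ≤ τ / 2 := by
    rw [mul_div_assoc', div_le_div_iff₀ hden two_pos]
    have h4 : 0 ≤ 4 * Real.pi * a * C := by positivity
    nlinarith [h4, hτ.le]
  exact h2.trans h3

/-- Window arithmetic: inside the GP window with `K ≥ 2` and `√ρ ≤ A/(2R₁)` the torus is wider than
twice the range, `2R₁ < L`. [folklore] -/
theorem twice_range_lt_side {A R₁ ρ L : ℝ} {K : ℕ} (hA : 0 < A) (hR₁ : 0 < R₁) (hρ : 0 < ρ)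
    (hρA : ρ ≤ (A / (2 * R₁)) ^ 2) (hL : 0 < L) (hK : 2 ≤ K)
    (hwin : A / Real.sqrt ρ ≤ L / (K : ℝ)) : 2 * R₁ < L := by
  have hKr : (2 : ℝ) ≤ K := by exact_mod_cast hK
  have hsρ : 0 < Real.sqrt ρ := Real.sqrt_pos.2 hρ
  have hLK : L / (K : ℝ) ≤ L / 2 := div_le_div_of_nonneg_left hL.le two_pos hKr
  have hsqrt : Real.sqrt ρ ≤ A / (2 * R₁) := by
    calc Real.sqrt ρ ≤ Real.sqrt ((A / (2 * R₁)) ^ 2) := Real.sqrt_le_sqrt hρA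
      _ = A / (2 * R₁) := Real.sqrt_sq (by positivity)
  have hAR : 2 * R₁ ≤ A / Real.sqrt ρ := by
    rw [le_div_iff₀ hsρ]
    have h := mul_le_mul_of_nonneg_left hsqrt (by positivity : (0 : ℝ) ≤ 2 * R₁)
    rwa [mul_div_cancel₀ A (by positivity : (2 : ℝ) * R₁ ≠ 0)] at h
  have h1 : 2 * R₁ ≤ L / 2 := hAR.trans (hwin.trans hLK)
  linarith

/-- Budget arithmetic in `ℝ≥0∞`: `E₀`-bound plus the affordable slack `(τ/2)ρN` stays below the
absolute budget `(4πa + τ)ρN`. [folklore] -/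
theorem budget_ennreal {a C t τ ρ₁ ρ N : ℝ} (ha : 0 ≤ a) (hC : 0 ≤ C) (ht : 0 ≤ t) (hN : 0 ≤ N)
    (hρ : 0 ≤ ρ) (hρ₁0 : 0 ≤ ρ₁) (hρ₁ : ρ₁ ≤ ρ) (hτ : 0 ≤ τ)
    (hkey : 4 * Real.pi * a * C * t ≤ τ / 2) :
    ENNReal.ofReal (4 * Real.pi * ρ₁ * a * (1 + C * t) * N) + ENNReal.ofReal (τ / 2 * ρ * N) ≤
      ENNReal.ofReal ((4 * Real.pi * a + τ) * ρ * N) := by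
  rw [← ENNReal.ofReal_add (by positivity) (by positivity)]
  refine ENNReal.ofReal_le_ofReal ?_
  have h2 : 4 * Real.pi * ρ₁ * a * (1 + C * t) * N ≤ 4 * Real.pi * ρ * a * (1 + C * t) * N := by
    gcongr
  have h3 : ρ * N * (4 * Real.pi * a * C * t) ≤ ρ * N * (τ / 2) :=
    mul_le_mul_of_nonneg_left hkey (mul_nonneg hρ hN)
  calc 4 * Real.pi * ρ₁ * a * (1 + C * t) * N + τ / 2 * ρ * N
      ≤ 4 * Real.pi * ρ * a * (1 + C * t) * N + τ / 2 * ρ * N := by linarith [h2]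
    _ = ρ * N * (4 * Real.pi * a) + ρ * N * (4 * Real.pi * a * C * t) + ρ * N * (τ / 2) := by ring
    _ ≤ ρ * N * (4 * Real.pi * a) + ρ * N * (τ / 2) + ρ * N * (τ / 2) := by linarith [h3]
    _ = (4 * Real.pi * a + τ) * ρ * N := by ring

/-! ### The carving `BlockCondensation ⟸ U ∧ F` -/

/-- **Carving theorem.** The periodic Dyson–LSSY upper bound (U) and the budget-form block floor
(F) imply the crux `BlockCondensation` of `BlockLatticeFSum`: U turns the `δ`-near-minimiser
hypothesis (with the affordable `δ = (τ/2)(N/L³)N`) into F's absolute budget once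
`ρ₀ ≤ ρ₀(F)`, `√ρ₀ ≤ A/(2·max R₀ 1)` (so that `2R₀ < L` inside the window, `twice_range_lt_side`)
and `ρ₀ ≤ ρs` of `densityCap_arith` (so that `a/b ≤ c` and `4πaC·a/b ≤ τ/2`). [folklore] -/
theorem blockCondensation_of_upperBound_floor (hU : LSSY2005_upperBound_periodic)
    (hF : PeriodicBudgetBlockFloor) : Theses.BlockLatticeFSum.BlockCondensation := by
  intro v hv A hA η hη
  obtain ⟨R₀, hR₀⟩ := hv.2
  have hR₁ : 0 < max R₀ 1 := lt_of_lt_of_le one_pos (le_max_right _ _)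
  have hR₁' : ∀ r, max R₀ 1 < r → v r = 0 :=
    fun r hr => hR₀ r (lt_of_le_of_lt (le_max_left _ _) hr)
  have hfin : scatteringLength v ≠ ⊤ := scatteringLength_ne_top_of_finiteRange hR₀
  have ha0 : 0 ≤ (scatteringLength v).toReal := ENNReal.toReal_nonneg
  obtain ⟨C, c, hC, hc, HU⟩ := hU v (max R₀ 1) hv.1 hR₁' hfin
  obtain ⟨ρF, hρF, τ, hτ, N₀F, HF⟩ := hF v hv A hA η hη
  obtain ⟨ρs, hρs, Hcap⟩ := densityCap_arith ha0 hC hc hτ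
  -- the density cap of the crux
  obtain ⟨ρ₀, hρ₀_def⟩ : ∃ ρ₀ : ℝ, ρ₀ = min ρF (min ((A / (2 * max R₀ 1)) ^ 2) ρs) := ⟨_, rfl⟩
  have hρ₀ : 0 < ρ₀ := by rw [hρ₀_def]; exact lt_min hρF (lt_min (by positivity) hρs)
  have hρ₀F : ρ₀ ≤ ρF := by rw [hρ₀_def]; exact min_le_left _ _
  have hρ₀A : ρ₀ ≤ (A / (2 * max R₀ 1)) ^ 2 := by
    rw [hρ₀_def]; exact (min_le_right _ _).trans (min_le_left _ _)
  have hρ₀s : ρ₀ ≤ ρs := by rw [hρ₀_def]; exact (min_le_right _ _).trans (min_le_right _ _)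
  refine ⟨ρ₀, hρ₀, max N₀F 2, fun N L hL hN hNL => ?_⟩
  have hNF : N₀F ≤ N := le_trans (le_max_left _ _) hN
  have h2N : 2 ≤ N := le_trans (le_max_right _ _) hN
  have hNr : (2 : ℝ) ≤ N := by exact_mod_cast h2N
  have hN1 : (0 : ℝ) < (N : ℝ) - 1 := by linarith
  have hL3 : 0 < L ^ 3 := by positivity
  have hρ : 0 < (N : ℝ) / L ^ 3 := div_pos (by linarith) hL3
  have hρle : (N : ℝ) / L ^ 3 ≤ ρ₀ := by rw [div_le_iff₀ hL3]; exact hNL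
  have hNLF : (N : ℝ) ≤ ρF * L ^ 3 := hNL.trans (mul_le_mul_of_nonneg_right hρ₀F hL3.le)
  -- the affordable slack `δ = (τ/2)·ρ·N`
  refine ⟨ENNReal.ofReal (τ / 2 * ((N : ℝ) / L ^ 3) * N), ENNReal.ofReal_pos.2 (by positivity),
    fun Ψ hΨ K hKe hK hwin => ?_⟩
  have hK2 : 2 ≤ K := by obtain ⟨k', hk'⟩ := hKe; omega
  -- the torus is wider than twice the range, so U applies
  have h2R : 2 * max R₀ 1 < L :=
    twice_range_lt_side hA hR₁ hρ (hρle.trans hρ₀A) hL hK2 hwin.1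
  have hρ₁ : 0 < ((N : ℝ) - 1) / L ^ 3 := div_pos hN1 hL3
  have hρ₁le : ((N : ℝ) - 1) / L ^ 3 ≤ (N : ℝ) / L ^ 3 :=
    div_le_div_of_nonneg_right (by linarith) hL3.le
  obtain ⟨htc, hkey⟩ := Hcap (((N : ℝ) - 1) / L ^ 3) hρ₁ (hρ₁le.trans (hρle.trans hρ₀s))
  have hE0 := HU N L h2N hL h2R htc
  have hx : 0 < 4 * Real.pi * (((N : ℝ) - 1) / L ^ 3) / 3 := by positivity
  have ht0 : 0 ≤ (scatteringLength v).toReal /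
      (4 * Real.pi * (((N : ℝ) - 1) / L ^ 3) / 3) ^ (-(1 : ℝ) / 3) :=
    div_nonneg ha0 (Real.rpow_nonneg hx.le _)
  -- the near-minimiser meets F's absolute budget
  have hbudget : periodicEnergy v Ψ ≤ ENNReal.ofReal
      ((4 * Real.pi * (scatteringLength v).toReal + τ) * ((N : ℝ) / L ^ 3) * N) :=
    (hΨ.trans (add_le_add hE0 le_rfl)).trans
      (budget_ennreal ha0 hC.le ht0 (by positivity) hρ.le hρ₁.le hρ₁le hτ.le hkey)
  -- F in the box, read through the block-mode identity
  have hfloor := HF N L hL hNF hNLF Ψ hbudget K hKe hK hwin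
  rw [← sum_cellOccupation_block_eq hK hL Ψ.ψ] at hfloor
  exact hfloor

/-- **The crux modulo F.** With U discharged by the tree (`LSSY2005_upperBound_periodic_holds`),
the budget-form block floor F alone implies `BlockCondensation` (route `BlockLatticeFSum`).
[folklore] -/
theorem blockCondensation_of_floor (hF : PeriodicBudgetBlockFloor) :
    Theses.BlockLatticeFSum.BlockCondensation :=
  blockCondensation_of_upperBound_floor LSSY2005_upperBound_periodic_holds hF

/-- The two route files carry ONE decl body for `BlockCondensation`. [tree] -/
theorem rotor_blockCondensation_iff :
    Theses.BECIntegerBlockRotor.BlockCondensation ↔ Theses.BlockLatticeFSum.BlockCondensation :=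
  Iff.rfl

/-- **The crux modulo F**, for the rotor route's decl (rank 5 of `BECIntegerBlockRotor`).
[folklore] -/
theorem rotor_blockCondensation_of_floor (hF : PeriodicBudgetBlockFloor) :
    Theses.BECIntegerBlockRotor.BlockCondensation :=
  rotor_blockCondensation_iff.2 (blockCondensation_of_floor hF)

/-- **The crux modulo the boundary-condition-free leaf F♭** (route `BlockLatticeFSum`).
[folklore] -/
theorem blockCondensation_of_cellNFloor (h : CellNBudgetBlockFloor) :
    Theses.BlockLatticeFSum.BlockCondensation :=
  blockCondensation_of_floor (periodicBudgetBlockFloor_of_cellN h)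

/-- **The crux modulo F♭**, rotor route's decl. [folklore] -/
theorem rotor_blockCondensation_of_cellNFloor (h : CellNBudgetBlockFloor) :
    Theses.BECIntegerBlockRotor.BlockCondensation :=
  rotor_blockCondensation_of_floor (periodicBudgetBlockFloor_of_cellN h)

end Summit.AtomisticToContinuum.BoseEinsteinCondensation.Theorems.BlockCondensationCarving

end
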